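import Literature.IUT.LogVolume.GenuineLogThetaPoint
import HarnessLib

/-!
# `−|log(Θ)|` in the PER-(SLOT-)IMAGE reading of [IUTchIII] Cor. 3.12, as DEFINED numbers for a genuine input
# (cell abc-iut, RISK 7 option (R3′); abc-iut-plan ruling 2026-08-26T02:51:47Z "(P)-object")

[IUTchIII] Cor. 3.12 (kurims May-2020 manuscript `paper:url-4b091feeb646`, p. 174 l. 25–48, read on the page via the
cell's verbatim transcription lit/COR312-PROOF-STEPS-X-XII-VERBATIM.md) writes `−|log(Θ)|` as the procession-normalized
log-volume of «the holomorphic hulls of … the various unions … of the possible images of a Θ-pilot object … which we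
regard as subject to the indeterminacies (Ind1), (Ind2), (Ind3)» — reading **(U)**, the UNION over all indeterminacies
before the hull; this is the number `ThetaVolumeInput.negLogTheta` of `GenuineLogTheta.lean`. Step (x) of the same
proof (p. 181 l. 2–32) says of these log-volumes: «the resulting log-volumes ∈ ℝ are invariant with respect to the
indeterminacies (Ind1), (Ind2), and have the effect of converting the indeterminacy (Ind3) into an inequality [from
above]» (and Prop. 3.9 (i) p. 116 / (iii) p. 117: «μ^log_{A,v_ℚ} is invariant with respect to permutations of A») —
reading **(P)**: one log-volume per image, the hull taken WITHOUT first forming the union over the capsule-index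
permutations of (Ind1). [IUTchIV] Thm. 1.10 Step (v) (kurims Apr-2020 ms p. 27–28) computes its per-collection bound
with the theta value «λ» at ONE distinguished index `i† ∈ S±_{j+1}` and then says «after symmetrizing with respect to
the choice of i† … after passing to weighted averages, the operation of symmetrizing … does not affect the computation
of the upper bound» — exact for reading (P) at every `d_mod`, false for reading (U) at mixed collections (cell note
plan/c312/STEPV-IND1-NOTE.md, the `λ_min` form; the two readings agree on slot-constant data, e.g. `F_mod = ℚ`).

THIS FILE (definitions only; statements-first) types reading (P) next to the landed reading (U), for the SAME genuine
input `I : ThetaVolumeInput F₀ K` and the same SHARP (Ind3) datum: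
* DH-model level: `IndPacketModel.UThetaSlot D` — the possible images with the IDENTITY slot datum, i.e. the union
  over (Ind2) only (`⋃_g g·(O_𝕃(−P_Θ))^{Ind3}_{v⃗}`; the (Ind2) maps and the per-strip automorphisms are lattice
  automorphisms of the FIXED summand `⊗_{i∈I} K_{v̲_i}`, the «arbitrary φ» of [IUTchIV] Prop. 1.4 (iii) — they stay
  inside, only the slot permutations moving a collection `v⃗∘σ ↦ v⃗` are left out), `hullUThetaSlot D`, and the
  inclusions `UThetaSlot ⊆ UThetaUnion`, `hullUThetaSlot ⊆ hullUTheta`;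
* prime-packet level (Literature twins, same formulas): `PrimePacket.slotImages`, `slotImagesHull`,
  `negLogThetaPerImageAt`;
* for the genuine input: `negLogThetaPerImageNonarch I := Σ_{p ∈ T(I)} ln ν̄_{𝕃_p}(hull(⋃_g g·O_𝕃(−P_Θ)_p))`,
  `negLogThetaPerImage I := … + ((l+5)/4)·log π`, the CLAIM-form Props `Cor312PerImageOf I`
  (`−|log(q)| ≤ −|log(Θ)|_(P)`), `Cor312PerImageNonarchOf I`, and the computable half `HullEstimatePerImageOf I δ`;
* at the Θ-data of a point `(P, l)` of the `λ`-line (mirroring `Cor22.Cor312AtDatum` / `Cor22.HullVolumeAtDatum`):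
  `Cor22.Cor312PerImageAtDatum P l`, `Cor22.HullVolumePerImageAtDatum P l δ`, the squeeze `gap_le_at_perImage`.
Elementary relations recorded here: `hull(U_(P)) ⊆ hull(U_(U))` componentwise, and the arithmetic consequences of the
volume comparison `vol_(P) ≤ vol_(U)` (which the summit-side companion `LDHGenuinePerImage.lean` proves for the genuine
datum): (P) is the STRONGER hypothesis (`Cor312PerImageOf → Cor312Of` given `vol_(P) ≤ vol_(U)`), and every hull
estimate for (U) is one for (P). The companion also proves the per-image Step (v) estimate `HullEstimatePerImageOf`
for EVERY genuine datum (no slot-constancy), and records σ-independence.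

[cite: Mochizuki2012, IUTchIII Cor. 3.12 p. 174] [cite: Mochizuki2012, IUTchIII Cor. 3.12 proof Step (x) p. 181]
[cite: Mochizuki2012, IUTchIII Prop. 3.9 (i) p. 116] [cite: Mochizuki2012, IUTchIV Thm. 1.10 Step (v) p. 27–28]
[cite: DupuyHilado2025, §4.9, §4.11–4.12] [claim: Mochizuki2012, status: disputed] for every IUT quotation.
HONEST SCOPE: nothing here asserts either reading of Cor. 3.12; which number print's `−|log(Θ)|` denotes is a
referee question (ref-b, locator question of the 02:51:47Z ruling); typed ≠ proved; an instance ≠ an endorsement.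
-/

noncomputable section

namespace Literature.IUT.LogVolume

open NumberField IsDedekindDomain Set
open scoped Pointwise

universe u

/-! ## DH-model level: the possible images at the identity slot datum, and their hull -/

namespace IndPacketModel

variable {F : Type*} [Field F] [NumberField F] (M : IndPacketModel F)

/-- **The possible images with the IDENTITY slot datum** — the union over the (Ind2) group of each summand only:
`(U_Θ^slot)_{p,j,v⃗} := ⋃_{g ∈ G₂(v⃗)} g·(O_𝕃(−P_Θ))^{Ind3}_{p,j,v⃗}` (no transport from the summands `v⃗∘σ`, `σ ≠ 1`).
Reading (P) of the module docstring. [cite: Mochizuki2012, IUTchIII Cor. 3.12 proof Step (x) p. 181] -/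
def UThetaSlot {lstar : ℕ} {t : M.LgpIdele lstar} (D : M.Ind3Datum t) : M.Region :=
  fun p j e => ⋃ g : M.G₂ p j e, g • D.bare3 p j e

/-- The (Ind3)-region lies in its slot images (identity of (Ind2)). [cite: DupuyHilado2025, §4.11] -/
theorem bare3_subset_UThetaSlot {lstar : ℕ} {t : M.LgpIdele lstar} (D : M.Ind3Datum t) (p j : ℕ)
    (e : Fin (j + 1) → placesOver F p) : D.bare3 p j e ⊆ M.UThetaSlot D p j e := by
  intro x hx
  refine Set.mem_iUnion.mpr ⟨1, ?_⟩
  rw [one_smul]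
  exact hx

/-- **The slot images lie in the union of ALL possible images** (`U_Θ^slot ⊆ U_Θ`: extend the local (Ind2)-element
by identities and take the identity (Ind1)-element). [cite: DupuyHilado2025, §4.11] -/
theorem UThetaSlot_subset_UThetaUnion {lstar : ℕ} {t : M.LgpIdele lstar} (D : M.Ind3Datum t) (p j : ℕ)
    (e : Fin (j + 1) → placesOver F p) : M.UThetaSlot D p j e ⊆ M.UThetaUnion D p j e := by
  classical
  intro x hx
  obtain ⟨g, hx⟩ := Set.mem_iUnion.mp hx
  -- extend `g` by identities to a global (Ind2)-element
  let G : M.Ind2Elt := Function.update (fun _ => 1 : M.Ind2Elt)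
    p (Function.update (fun _ => 1 : (j' : ℕ) → (e' : Fin (j' + 1) → placesOver F p) → M.G₂ p j' e')
      j (Function.update (fun _ => 1 : (e' : Fin (j + 1) → placesOver F p) → M.G₂ p j e') e g))
  have hG : G p j e = g := by simp [G]
  refine Set.mem_iUnion.mpr ⟨(G, fun _ => 1), ?_⟩
  show x ∈ G p j e •
    (M.perm (1 : Equiv.Perm (Fin (j + 1))) e '' D.bare3 p j (e ∘ ⇑(1 : Equiv.Perm (Fin (j + 1)))))
  rw [hG]
  obtain ⟨y, hy, rfl⟩ : ∃ y ∈ D.bare3 p j e, g • y = x := Set.mem_smul_set.mp hx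
  exact Set.smul_mem_smul_set ⟨y, hy, M.perm_one e y⟩

/-- **`hull(U_Θ^slot)`**: the holomorphic hull of the slot images — the region whose log-volume is `−|log(Θ)|` in
reading (P). [cite: Mochizuki2012, IUTchIII Cor. 3.12 proof Step (x) p. 181] -/
def hullUThetaSlot {lstar : ℕ} {t : M.LgpIdele lstar} (D : M.Ind3Datum t) : M.Region :=
  M.hull (M.UThetaSlot D)

/-- The hull, componentwise. [cite: DupuyHilado2025, §4.12] -/
theorem hullUThetaSlot_apply {lstar : ℕ} {t : M.LgpIdele lstar} (D : M.Ind3Datum t) (p j : ℕ)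
    (e : Fin (j + 1) → placesOver F p) :
    M.hullUThetaSlot D p j e = M.hullLoc p j e (M.UThetaSlot D p j e) := rfl

/-- The slot images lie in their hull. [cite: DupuyHilado2025, §4.12] -/
theorem UThetaSlot_le_hullUThetaSlot {lstar : ℕ} {t : M.LgpIdele lstar} (D : M.Ind3Datum t) :
    M.UThetaSlot D ≤ M.hullUThetaSlot D :=
  M.le_hull _

/-- **`hull(U_Θ^slot) ⊆ hull(U_Θ)`** componentwise (the hull is monotone): the region of reading (P) lies in the
region of reading (U). [cite: DupuyHilado2025, §4.11–4.12] -/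
theorem hullUThetaSlot_subset_hullUTheta {lstar : ℕ} {t : M.LgpIdele lstar} (D : M.Ind3Datum t) (p j : ℕ)
    (e : Fin (j + 1) → placesOver F p) : M.hullUThetaSlot D p j e ⊆ M.hullUTheta D p j e := by
  rw [hullUThetaSlot_apply, IndPacketModel.hullUTheta, IndPacketModel.hull_apply]
  exact (M.hullLoc p j e).monotone (M.UThetaSlot_subset_UThetaUnion D p j e)

end IndPacketModel

/-! ## Prime-packet level (the Literature twins read by the genuine input) -/

namespace PrimePacket

variable {F : Type u} [Field F] [NumberField F] {p : ℕ} (Q : PrimePacket F p)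

/-- **The slot images of a region**, summand by summand: `⋃_{g ∈ G₂(v⃗)} g·B_{v⃗}` — the (Ind2)-orbit at the identity
slot datum (compare `possibleImages`, which also ranges over the factor permutations `σ ∈ 𝔖_{j+1}`).
[cite: Mochizuki2012, IUTchIII Cor. 3.12 proof Step (x) p. 181] -/
def slotImages (B : Q.Region) : Q.Region := fun j e => ⋃ g : Q.G₂ j e, g • B j e

/-- **The holomorphic hull of the slot images**, summand by summand. [cite: DupuyHilado2025, §4.12] -/
def slotImagesHull (B : Q.Region) : Q.Region := fun j e => Q.hullLoc j e (Q.slotImages B j e)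

/-- **`−|log(Θ)|_p` in reading (P)** for the SHARP (Ind3)-datum: `ln ν̄_{𝕃_p}` of the hull of the slot images of
`O_𝕃(−div t_Θ)_p`. [cite: Mochizuki2012, IUTchIII Cor. 3.12 proof Step (x) p. 181] -/
def negLogThetaPerImageAt (lstar : ℕ) (t : Fin lstar → (v : placesOver F p) → Q.Λ v) : ℝ :=
  Q.lnνLp lstar (Q.slotImagesHull (Q.pilotRegion t))

/-- A region lies in its slot images (identity of (Ind2)). [cite: DupuyHilado2025, §4.11] -/
theorem subset_slotImages (B : Q.Region) (j : ℕ) (e : Fin (j + 1) → placesOver F p) :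
    B j e ⊆ Q.slotImages B j e := by
  intro x hx
  refine mem_iUnion.mpr ⟨1, ?_⟩
  rw [one_smul]
  exact hx

/-- The slot images lie in the union of all possible images (`σ = 1`). [cite: DupuyHilado2025, §4.11] -/
theorem slotImages_subset_possibleImages (B : Q.Region) (j : ℕ) (e : Fin (j + 1) → placesOver F p) :
    Q.slotImages B j e ⊆ Q.possibleImages B j e := by
  intro x hx
  obtain ⟨g, hx⟩ := mem_iUnion.mp hx
  refine mem_iUnion.mpr ⟨g, mem_iUnion.mpr ⟨1, ?_⟩⟩
  obtain ⟨y, hy, rfl⟩ : ∃ y ∈ B j e, g • y = x := Set.mem_smul_set.mp hx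
  exact Set.smul_mem_smul_set ⟨y, hy, Q.perm_one e y⟩

/-- The slot images lie in their hull. [cite: DupuyHilado2025, §4.12] -/
theorem slotImages_subset_hull (B : Q.Region) (j : ℕ) (e : Fin (j + 1) → placesOver F p) :
    Q.slotImages B j e ⊆ Q.slotImagesHull B j e :=
  (Q.hullLoc j e).le_closure _

/-- **`hull(slot images) ⊆ hull(all possible images)`** summand by summand: reading (P)'s region lies in reading
(U)'s. [cite: DupuyHilado2025, §4.11–4.12] -/
theorem slotImagesHull_subset_possibleImagesHull (B : Q.Region) (j : ℕ) (e : Fin (j + 1) → placesOver F p) :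
    Q.slotImagesHull B j e ⊆ Q.possibleImagesHull B j e :=
  (Q.hullLoc j e).monotone (Q.slotImages_subset_possibleImages B j e)

end PrimePacket

namespace IndPacketModel

variable {F : Type u} [Field F] [NumberField F] (M : IndPacketModel F)

/-- The `p`-component of `U_Θ^slot` of a model is the slot-image region of its `p`-part (definitionally).
[cite: DupuyHilado2025, §4.11] -/
theorem UThetaSlot_eq_slotImages {lstar : ℕ} {t : M.LgpIdele lstar} (D : M.Ind3Datum t) (p j : ℕ)
    (e : Fin (j + 1) → placesOver F p) :
    M.UThetaSlot D p j e = (M.primePart p).slotImages (M.regionAt D.bare3 p) j e := rfl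

/-- The `p`-component of `hull(U_Θ^slot)` of a model is the slot-image hull of its `p`-part (definitionally).
[cite: DupuyHilado2025, §4.12] -/
theorem hullUThetaSlot_eq_slotImagesHull {lstar : ℕ} {t : M.LgpIdele lstar} (D : M.Ind3Datum t) (p j : ℕ)
    (e : Fin (j + 1) → placesOver F p) :
    M.hullUThetaSlot D p j e = (M.primePart p).slotImagesHull (M.regionAt D.bare3 p) j e := rfl

end IndPacketModel

/-! ## The genuine input: `−|log(Θ)|` in reading (P), Cor. 3.12 in reading (P), the computable half -/

namespace ThetaVolumeInput

variable {F₀ : Type} [Field F₀] [NumberField F₀] {K : Type} [Field K] [NumberField K] [Algebra F₀ K]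
variable (I : ThetaVolumeInput F₀ K)

/-- The summand of `−|log(Θ)|_(P)` at the index `p` (`0` at a non-prime index, never summed).
[cite: Mochizuki2012, IUTchIII Cor. 3.12 proof Step (x) p. 181] -/
def negLogThetaPerImageLoc (p : ℕ) : ℝ :=
  if hp : p.Prime then (I.packetAt p hp).negLogThetaPerImageAt I.lstar (I.tΘ p hp) else 0

/-- At a prime the local summand is the packet-level quantity. [cite: DupuyHilado2025, Def. 3.6.3] -/
theorem negLogThetaPerImageLoc_of_prime {p : ℕ} (hp : p.Prime) :
    I.negLogThetaPerImageLoc p = (I.packetAt p hp).negLogThetaPerImageAt I.lstar (I.tΘ p hp) := by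
  rw [negLogThetaPerImageLoc, dif_pos hp]

/-- **The nonarchimedean part of `−|log(Θ)|_(P)`**: `Σ_{p ∈ T(I)} ln ν̄_{𝕃_p}(hull(U_Θ^slot)_p)` for the sharp datum
over the genuine completions. [cite: Mochizuki2012, IUTchIII Cor. 3.12 proof Step (x) p. 181] -/
def negLogThetaPerImageNonarch : ℝ := ∑ p ∈ I.supportPrimes, I.negLogThetaPerImageLoc p

/-- **`−|log(Θ)|_(P)`** for the input `I`: the nonarchimedean part plus the archimedean summand `((l+5)/4)·log π` of
[IUTchIV] Thm. 1.10 Step (vii) (unchanged: at an archimedean place every possible image has the same hull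
`π^{j+1}·B_I`). [cite: Mochizuki2012, IUTchIV Thm. 1.10 Step (vii) p. 30] -/
def negLogThetaPerImage : ℝ := I.negLogThetaPerImageNonarch + archLogTheta I.l

/-- **[IUTchIII] Corollary 3.12 FOR THE INPUT `I` IN READING (P)** — "`−|log(Θ)| ≥ −|log(q)|`" with `−|log(Θ)|` the
per-slot-image number of this file. STRONGER than `Cor312Of I` whenever `vol_(P) ≤ vol_(U)` (summit-side companion).
A `Prop`, the cell's CLAIM form: DISPUTED in print (Scholze–Stix 2018 §2.2), never asserted here.
[claim: Mochizuki2012, status: disputed] -/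
@[claim "Mochizuki2012" "disputed"]
def Cor312PerImageOf : Prop := I.negAbsLogQ ≤ I.negLogThetaPerImage

/-- The NONARCHIMEDEAN form of Cor. 3.12 in reading (P) (Dupuy–Hilado's (1.1) shape). A `Prop`, never asserted.
[claim: Mochizuki2012, status: disputed] -/
@[claim "Mochizuki2012" "disputed"]
def Cor312PerImageNonarchOf : Prop := I.negAbsLogQ ≤ I.negLogThetaPerImageNonarch

/-- The nonarchimedean form implies the (P)-form of Cor. 3.12 (add the positive archimedean summand).
[cite: Mochizuki2012, IUTchIV Thm. 1.10 Step (vii) p. 30] -/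
theorem cor312PerImageOf_of_nonarch (h : I.Cor312PerImageNonarchOf) : I.Cor312PerImageOf := by
  unfold Cor312PerImageNonarchOf at h
  unfold Cor312PerImageOf negLogThetaPerImage
  linarith [archLogTheta_pos I.l]

/-- **The computable half in reading (P)** ([IUTchIV] Thm. 1.10 Steps (v)–(viii) shape): the nonarchimedean part of
`−|log(Θ)|_(P)` is at most `−deĝ̲_lgp(P_Θ) + δ`. A `Prop`; PROVED summit-side for every genuine datum with the text's
Step (v)–(viii) constant (`LDHGenuinePerImage.lean`). [cite: Mochizuki2012, IUTchIV Thm. 1.10 Steps (v)–(viii) p. 27–31] -/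
def HullEstimatePerImageOf (δ : ℝ) : Prop :=
  I.negLogThetaPerImageNonarch ≤ -LgpDivisor.ndegLgp I.X.thetaPilot + δ

/-- `HullEstimatePerImageOf` is monotone in the constant. [cite: DupuyHilado2025, §4.12] -/
theorem hullEstimatePerImageOf_mono {δ δ' : ℝ} (h : I.HullEstimatePerImageOf δ) (hle : δ ≤ δ') :
    I.HullEstimatePerImageOf δ' := by
  unfold HullEstimatePerImageOf at h ⊢
  linarith

/-- **The squeeze in reading (P)**, as bookkeeping: Cor. 3.12 in reading (P) AND the per-image hull estimate with
`δ` give `deĝ̲_lgp(P_Θ) − deĝ̲(P_q) ≤ δ + ((l+5)/4)·log π`. Pure arithmetic of the two `Prop`s; no side taken.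
[cite: DupuyHilado2025, §1 (1.1)] -/
theorem gap_le_of_cor312PerImageOf_of_hullEstimatePerImageOf {δ : ℝ} (h1 : I.Cor312PerImageOf)
    (h2 : I.HullEstimatePerImageOf δ) :
    LgpDivisor.ndegLgp I.X.thetaPilot - FinDivisor.ndeg F₀ I.X.qPilot ≤ δ + archLogTheta I.l := by
  unfold Cor312PerImageOf negLogThetaPerImage negAbsLogQ at h1
  unfold HullEstimatePerImageOf at h2
  linarith

/-- **(P) is the stronger hypothesis**, given the volume comparison `vol_(P) ≤ vol_(U)` (proved summit-side for the
genuine datum as `negLogThetaPerImageNonarch_le_negLogThetaNonarch`): Cor. 3.12 in reading (P) implies Cor. 3.12 in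
reading (U). [cite: Mochizuki2012, IUTchIII Cor. 3.12 proof Step (x) p. 181] -/
theorem cor312Of_of_cor312PerImageOf_of_le (hle : I.negLogThetaPerImageNonarch ≤ I.negLogThetaNonarch)
    (h : I.Cor312PerImageOf) : I.Cor312Of := by
  unfold Cor312PerImageOf negLogThetaPerImage at h
  unfold Cor312Of negLogTheta
  linarith

/-- The nonarchimedean forms compare the same way. [cite: Mochizuki2012, IUTchIII Cor. 3.12 proof Step (x) p. 181] -/
theorem cor312NonarchOf_of_cor312PerImageNonarchOf_of_le
    (hle : I.negLogThetaPerImageNonarch ≤ I.negLogThetaNonarch) (h : I.Cor312PerImageNonarchOf) :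
    I.Cor312NonarchOf := by
  unfold Cor312PerImageNonarchOf at h
  unfold Cor312NonarchOf
  linarith

/-- Conversely on the computable side: given `vol_(P) ≤ vol_(U)`, every hull estimate in reading (U) is a hull
estimate in reading (P). [cite: Mochizuki2012, IUTchIV Thm. 1.10 Steps (v)–(viii) p. 27–31] -/
theorem hullEstimatePerImageOf_of_hullEstimateOf_of_le
    (hle : I.negLogThetaPerImageNonarch ≤ I.negLogThetaNonarch) {δ : ℝ} (h : I.HullEstimateOf δ) :
    I.HullEstimatePerImageOf δ := by
  unfold HullEstimateOf at h
  unfold HullEstimatePerImageOf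
  linarith

end ThetaVolumeInput

/-! ## At the Θ-data of a point `(P, l)` of the `λ`-line -/

namespace Cor22

open Literature.NumberTheory.DiophantineGeometry.GenEll

namespace ThetaVolumeDatumAt

variable {P : NFPoint} {l : ℕ} (T : ThetaVolumeDatumAt P l)

/-- **`−|log(Θ)|_(P)` AT THE DATUM** `T` (the per-slot-image number of the datum's genuine input).
[cite: Mochizuki2012, IUTchIII Cor. 3.12 proof Step (x) p. 181] -/
def negLogThetaPerImage : ℝ :=
  letI := T.instFieldF; letI := T.instNumberFieldF; letI := T.instFieldK; letI := T.instNumberFieldK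
  letI := T.instAlgebraK
  T.I.negLogThetaPerImage

/-- [IUTchIII] Cor. 3.12 in reading (P) for the datum `T`. CLAIM form, never asserted.
[claim: Mochizuki2012, status: disputed] -/
def Cor312PerImageOf : Prop :=
  letI := T.instFieldF; letI := T.instNumberFieldF; letI := T.instFieldK; letI := T.instNumberFieldK
  letI := T.instAlgebraK
  T.I.Cor312PerImageOf

/-- Its nonarchimedean form for the datum `T`. CLAIM form, never asserted. [claim: Mochizuki2012, status: disputed] -/
def Cor312PerImageNonarchOf : Prop :=
  letI := T.instFieldF; letI := T.instNumberFieldF; letI := T.instFieldK; letI := T.instNumberFieldK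
  letI := T.instAlgebraK
  T.I.Cor312PerImageNonarchOf

/-- The computable half in reading (P) for the datum `T` with discrepancy `δ`.
[cite: Mochizuki2012, IUTchIV Thm. 1.10 Steps (v)–(viii) p. 27–31] -/
def HullEstimatePerImageOf (δ : ℝ) : Prop :=
  letI := T.instFieldF; letI := T.instNumberFieldF; letI := T.instFieldK; letI := T.instNumberFieldK
  letI := T.instAlgebraK
  T.I.HullEstimatePerImageOf δ

/-- `Cor312PerImageOf T` unfolds to `−|log(q)| ≤ −|log(Θ)|_(P)` at the datum. [claim: Mochizuki2012, status: disputed] -/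
theorem cor312PerImageOf_iff : T.Cor312PerImageOf ↔ T.negAbsLogQ ≤ T.negLogThetaPerImage := Iff.rfl

/-- The nonarchimedean form implies the (P)-form for the datum. [cite: Mochizuki2012, IUTchIV Thm. 1.10 Step (vii) p. 30] -/
theorem cor312PerImageOf_of_nonarch (h : T.Cor312PerImageNonarchOf) : T.Cor312PerImageOf :=
  letI := T.instFieldF; letI := T.instNumberFieldF; letI := T.instFieldK; letI := T.instNumberFieldK
  letI := T.instAlgebraK
  T.I.cor312PerImageOf_of_nonarch h

/-- **The squeeze for the datum in reading (P)**: `deĝ̲_lgp(P_Θ) − deĝ̲(P_q) ≤ δ + ((l+5)/4)·log π`. Pure arithmetic;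
no side taken. [cite: Mochizuki2012, IUTchIV Thm. 1.10 Steps (viii)–(x) p. 30–32] -/
theorem gap_le_perImage {δ : ℝ} (h1 : T.Cor312PerImageOf) (h2 : T.HullEstimatePerImageOf δ) :
    T.gap ≤ δ + ThetaVolumeInput.archLogTheta l := by
  letI := T.instFieldF; letI := T.instNumberFieldF; letI := T.instFieldK; letI := T.instNumberFieldK
  letI := T.instAlgebraK
  have h := T.I.gap_le_of_cor312PerImageOf_of_hullEstimatePerImageOf h1 h2
  rw [T.l_eq] at h
  exact h

end ThetaVolumeDatumAt

/-- **`negLogThetaPerImageAtDatum T := −|log(Θ)|_(P)` of the genuine datum `T` at `(P, l)`.**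
[cite: Mochizuki2012, IUTchIII Cor. 3.12 proof Step (x) p. 181] -/
abbrev negLogThetaPerImageAtDatum {P : NFPoint} {l : ℕ} (T : ThetaVolumeDatumAt P l) : ℝ := T.negLogThetaPerImage

/-- **[IUTchIII] Corollary 3.12 IN READING (P) AT THE Θ-DATA OF `(P, l)`**: for every genuine Θ-volume datum at
`(P, l)`, "`−|log(Θ)| ≥ −|log(q)|`" for ITS per-slot-image `−|log(Θ)|`. CLAIM form; DISPUTED in print; never
asserted here. The (P)-typed twin of `Cor312AtDatum` (route stub (iii-P) of the RESHAPE-3 pre-announcement).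
[claim: Mochizuki2012, status: disputed] -/
@[claim "Mochizuki2012" "disputed"]
def Cor312PerImageAtDatum (P : NFPoint) (l : ℕ) : Prop := ∀ T : ThetaVolumeDatumAt P l, T.Cor312PerImageOf

/-- Its NONARCHIMEDEAN form at the Θ-data of `(P, l)` (the stronger of the two). CLAIM form; never asserted.
[claim: Mochizuki2012, status: disputed] -/
@[claim "Mochizuki2012" "disputed"]
def Cor312PerImageNonarchAtDatum (P : NFPoint) (l : ℕ) : Prop :=
  ∀ T : ThetaVolumeDatumAt P l, T.Cor312PerImageNonarchOf

/-- **The computable half in reading (P) AT THE Θ-DATA OF `(P, l)`**: for every genuine datum, the nonarchimedean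
part of its `−|log(Θ)|_(P)` is at most `−deĝ̲_lgp(P_Θ) + δ` — the (P)-typed twin of `HullVolumeAtDatum` (route stub
(ii′-P)). [cite: Mochizuki2012, IUTchIV Thm. 1.10 Steps (v)–(viii) p. 27–31] -/
def HullVolumePerImageAtDatum (P : NFPoint) (l : ℕ) (δ : ℝ) : Prop :=
  ∀ T : ThetaVolumeDatumAt P l, T.HullEstimatePerImageOf δ

/-- `Cor312PerImageAtDatum P l` unfolded. [claim: Mochizuki2012, status: disputed] -/
theorem cor312PerImageAtDatum_iff {P : NFPoint} {l : ℕ} :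
    Cor312PerImageAtDatum P l ↔
      ∀ T : ThetaVolumeDatumAt P l, negAbsLogQAtDatum T ≤ negLogThetaPerImageAtDatum T := Iff.rfl

/-- The nonarchimedean form implies the (P)-form at `(P, l)`. [cite: Mochizuki2012, IUTchIV Thm. 1.10 Step (vii) p. 30] -/
theorem cor312PerImageAtDatum_of_nonarch {P : NFPoint} {l : ℕ} (h : Cor312PerImageNonarchAtDatum P l) :
    Cor312PerImageAtDatum P l :=
  fun T => T.cor312PerImageOf_of_nonarch (h T)

/-- **The squeeze at `(P, l)` in reading (P)**: Cor. 3.12 (P) at the Θ-data AND the per-image hull estimate with `δ`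
give `deĝ̲_lgp(P_Θ) − deĝ̲(P_q) ≤ δ + ((l+5)/4)·log π` for every datum. No side taken.
[cite: Mochizuki2012, IUTchIV Thm. 1.10 Steps (viii)–(x) p. 30–32] -/
theorem gap_le_at_perImage {P : NFPoint} {l : ℕ} {δ : ℝ} (h1 : Cor312PerImageAtDatum P l)
    (h2 : HullVolumePerImageAtDatum P l δ) (T : ThetaVolumeDatumAt P l) :
    T.gap ≤ δ + ThetaVolumeInput.archLogTheta l :=
  T.gap_le_perImage (h1 T) (h2 T)

/-- Vacuity record: with NO datum at `(P, l)` the (P)-claim holds trivially (read together with `ThetaDataExistsAt`).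
[cite: Mochizuki2012, IUTchIV Cor. 2.2 (ii) proof p. 46] -/
theorem cor312PerImageAtDatum_of_not_exists {P : NFPoint} {l : ℕ} (h : ¬ ThetaDataExistsAt P l) :
    Cor312PerImageAtDatum P l :=
  fun T => absurd ⟨T⟩ h

end Cor22

end Literature.IUT.LogVolume

end
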